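import Summits.BirchSwinnertonDyer.Rank1Residual.Additive.CensusX42ValRelation
import Summits.BirchSwinnertonDyer.Rank1Residual.Additive.CongruentPartnerBranchPAdicGrossZagierIff
import HarnessLib

/-!
# Census relation X4-2 at WINDOW grade, II: the valuation relation ⟹ the typed branch `p`-adic
# Gross–Zagier inputs, and the `∀ Dh` suppliers (cell `b2b-bsdres`, census cell `bsd-formula-census`,
# seat `b2b-bsdres-census-ctyper1` = conjecture-typer 1, gen 6; sibling of `CensusX42ValRelation.lean`)

HONEST FRAMING (cell `b2b-bsdres`, run/shared/lean/b2b/bsd-rank1-residual/, verbatim in every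
file): the goal of the cell is to DELETE the COMBINATION-SHAPED residual classes of the
Birch–Swinnerton-Dyer formula for ALL analytic-rank `≤ 1` elliptic curves over `ℚ` — "full BSD
formula for every rank `≤ 1` curve in class `C`" assembled STRICTLY from published theorems — so
that the rank-`≤ 1` remainder becomes exactly the CONSTRUCTION-SHAPED classes, which are TYPED
(missing-input `Prop`s), NOT attempted. This is not "finishing BSD". Census cell
(bsd-formula-census): research instrumentation; census output = EVIDENCE / conjecture items, never a
Literature fact; labels / RESIDUAL-MAP marks UNCHANGED (O7-ord OPEN; X3♯ / X4♯ CONSTRUCTION-SHAPED);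
nothing booked. THEOREMS ONLY (no definition, no named fact); named facts enter as HYPOTHESES
(Gross–Zagier I.(7.3) `hGZ`, GZK `hGZK`, modularity `hmodD`; in the unit-row file also Kato 2004
Thm. 17.4 (3) `hK`, Wuthrich 2014 Thm. 16 `hWu`/`hW16`); the census relation
`CensusX42.ValRelationAt W p Dh` (`CensusX42ValRelation.lean`, `@[conjecture]`, X4-2 at WINDOW grade —
EVIDENCE: X42-REPORT.md sha256 `e8592c9a2e1a59c13e754928288c9f6b1ce554f7ffb80b93db3c55aa7f5e9950`,
X42-WINDOW.md sha256 `a10a170979128fde17cf31b1704581a6d978f587434da820ed86243fc49ef835`) is a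
HYPOTHESIS at the pair (resp. for every (B)-datum).

## What

p01's typed rank-one inputs `BranchPAdicGrossZagierAt W p Dh` (even branch, `GordBranchPAdicGrossZagier`),
`BranchPAdicGrossZagierOddAt W p Dh` (odd branch) and `BranchPAdicGrossZagierMultAt W p Dh` ((M) locus) ask for
`ϖ·[T^r]B·log_p(γ)^r = u·q·Reg_p(E,Dh)` with SOME unit `u ∈ ℤ_p^×` and `q` the rational BSD quotient — an
"up to a `p`-adic unit" statement, i.e. Delbourgo 1998 BS-D(p)(ii)'s own shape. Hence the VALUATION
relation `ValRelationAt W p Dh` (norm clause `‖ϖ·[T¹]L·log_p(γ)·#T²‖ = ‖s·Reg_p(E,Dh)·∏c‖` with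
`[T¹]L ≠ 0`) already supplies them, with `u := (ϖ·[T¹]L·log_p γ)/((s∏c/#T²)·Reg_p(E,Dh))`
(`PadicInt.mkUnits`) and `q = #Ш_an·∏c/#T²` (`leadingLCoeff_eq_of_shaAn_eq`):
`branchPAdicGrossZagierAt_of_valRelationAt`, `branchPAdicGrossZagierOddAt_of_valRelationAt`,
`branchPAdicGrossZagierMultAt_of_valRelationAt` (the gen-2 / gen-4 bridges from the EXACT relation,
`CensusX42Bridge(s).lean`, are their corollaries through `valRelationAt_of_relationAt`). §2 packages, per
locus, the hypothesis `hGZ : ∀ Dh, LeadingTermClauses W p Dh → SchneiderConjecture Dh ∧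
BranchPAdicGrossZagier[∅|Odd|Mult]At W p Dh` of the n1011 rank-one class theorems (p01 IMC-version
iffs p255614 / p255891 / p256076, p16 (S10) p262041, p07 / p12 (M) and X3♯ twins) from
`∀ Dh, LeadingTermClauses → ValRelationAt W p Dh`:
`forall_schneider_and_branchPAdicGrossZagier[∅|Odd|Mult]At_of_forall_valRelationAt`; §3 shows the
plug on two of them — the IMC-version nodes `ClassX4Gord.bsdp_rankOne_of_chiBranchLower_of_katoHalf_of_forall_censusX42Val`
(`p ≡ 1 (mod 4)`) and `ClassX4M.bsdp_rankOne_of_quadraticBranchLower_of_katoHalf_of_forall_censusX42Val`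
(every odd `p`), the window-grade twins of gen 4's `CensusX42BSDIMC.lean` §1/§3. KERNEL READING (no
booking): every X4-2 consumer in the tree needs only the valuation relation; the pinned unit of the
`N ≤ 3000` fit is surplus; the 429 WINDOW pairs (valuations certified, two engines each side) feed the
same nodes at their own evidence grade, modulo the READING `h_census = Reg_p(E,Dh)` (never asserted).

References: D. Delbourgo, Compositio Math. 113 (1998) §2.5 BS-D(p) (i)(ii), pp. 151–152 [Delbourgo1998];
B. Gross, D. Zagier, Invent. Math. 84 (1986) Thm. I.(7.3) [GrossZagier1986]; B. Mazur, J. Tate,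
J. Teitelbaum, Invent. Math. 84 (1986) §I.10, §I.13 [MazurTateTeitelbaum1986Invent]; P. Schneider, Invent.
Math. 69 (1982) §1 [Schneider1982PadicHeightI]; census files of record (module docstring of
`CensusX42ValRelation.lean` / `CensusX42LeadingTerm.lean`).
-/

set_option autoImplicit false

noncomputable section

open scoped Classical MatrixGroups ModularForm NumberField

open CongruenceSubgroup WeierstrassCurve NumberField Literature.NumberTheory.EllipticCurves
  Literature.NumberTheory.EllipticCurves.ModularForms
  Literature.NumberTheory.EllipticCurves.Rank1Residual
  Literature.NumberTheory.EllipticCurves.Rank1Residual.Typed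
  Literature.NumberTheory.EllipticCurves.Delbourgo2002
  Literature.NumberTheory.GaloisRepresentations
  Literature.Barriers.BirchSwinnertonDyer
  IsDedekindDomain

namespace Summit.BirchSwinnertonDyer.Rank1Residual.Additive

namespace CensusX42

variable {p : ℕ} [hp : Fact p.Prime]

/-! ### §1 The three Gross–Zagier bridges from the valuation relation -/

omit hp in
/-- `‖x‖ = ‖y‖` with `x ≠ 0` exhibits a unit `u ∈ ℤ_p^×` with `x = u·y`. [folklore] -/
private theorem exists_unit_mul_of_norm_eq' [Fact p.Prime] {x y : ℚ_[p]} (hx : x ≠ 0) (h : ‖x‖ = ‖y‖) :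
    ∃ u : ℤ_[p]ˣ, x = ((u : ℤ_[p]) : ℚ_[p]) * y := by
  have hy : y ≠ 0 := by
    rintro rfl
    exact hx (norm_eq_zero.mp (by rw [h, norm_zero]))
  have hn : ‖x / y‖ = 1 := by
    rw [norm_div, h, div_self (norm_ne_zero_iff.mpr hy)]
  exact ⟨PadicInt.mkUnits hn, by rw [PadicInt.mkUnits_eq, div_mul_cancel₀ x hy]⟩

/-- The left side `ϖ·c₁·log_p(γ)·#T²` of the clause is non-zero once `c₁ ≠ 0`. [folklore] -/
private theorem lhs_ne_zero' {W : WeierstrassCurve ℚ} [W.IsElliptic] {ϖ : ℚ} (hϖ0 : (ϖ : ℚ_[p]) ≠ 0)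
    {c : ℚ_[p]} (hc : c ≠ 0) :
    (ϖ : ℚ_[p]) * c * padicLog p (cyclotomicGenerator p) * (W.torsionOrder : ℚ_[p]) ^ 2 ≠ 0 := by
  have hT : (W.torsionOrder : ℚ_[p]) ^ 2 ≠ 0 :=
    pow_ne_zero 2 (by exact_mod_cast (W.torsionOrder_pos_holds).ne')
  exact mul_ne_zero (mul_ne_zero (mul_ne_zero hϖ0 hc) (padicLog_cyclotomicGenerator_ne_zero p)) hT

/-- Shared last step of the three Gross–Zagier bridges: from `‖x·#T²‖ = ‖s·R·∏c‖`, `x ≠ 0`, exhibit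
`u ∈ ℤ_p^×` with `x = u · (s∏c/#T²) · R` (rank-one shape `coeff r = coeff 1`, `log^r = log`).
[folklore] -/
private theorem exists_unit_eq_of_norm_clause {W : WeierstrassCurve ℚ} [W.IsElliptic]
    (Dh : PAdicHeightData W p) (hrk : W.mordellWeilRank = 1) {ϖ s : ℚ} {c : ℚ_[p]}
    (hx : (ϖ : ℚ_[p]) * c * padicLog p (cyclotomicGenerator p) * (W.torsionOrder : ℚ_[p]) ^ 2 ≠ 0)
    (hn : ‖(ϖ : ℚ_[p]) * c * padicLog p (cyclotomicGenerator p) * (W.torsionOrder : ℚ_[p]) ^ 2‖ =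
      ‖(s : ℚ_[p]) * padicRegulator Dh * W.tamagawaProduct‖)
    {B : PowerSeries ℚ_[p]} (hB : PowerSeries.coeff 1 B = c) :
    ∃ u : ℤ_[p]ˣ, ((ϖ : ℚ) : ℚ_[p]) * PowerSeries.coeff W.mordellWeilRank B *
        padicLog p (cyclotomicGenerator p) ^ W.mordellWeilRank =
      ((u : ℤ_[p]) : ℚ_[p]) * ((s * W.tamagawaProduct / (W.torsionOrder : ℚ) ^ 2 : ℚ) : ℚ_[p]) *
        padicRegulator Dh := by
  obtain ⟨u, hu⟩ := exists_unit_mul_of_norm_eq' hx hn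
  have hT : (W.torsionOrder : ℚ_[p]) ≠ 0 := by exact_mod_cast (W.torsionOrder_pos_holds).ne'
  refine ⟨u, ?_⟩
  rw [hrk, pow_one, hB]
  push_cast
  field_simp
  linear_combination hu

/-- **Valuation relation ⟹ `BranchPAdicGrossZagierAt W p Dh`** (even branch, (G-ord), rank one; p01's
typed input is itself an "up to `u ∈ ℤ_p^×`" statement, so the valuation clause suffices; `q = #Ш_an·∏c/#T²`).
[cite: GrossZagier1986, Thm. I.(7.3)] [cite: MazurTateTeitelbaum1986Invent, §I.13] -/
theorem branchPAdicGrossZagierAt_of_valRelationAt (hGZ : GrossZagier1986_thm_I_7_3)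
    (hGZK : rank_eq_analyticRank_of_analyticRank_le_one)
    (W : WeierstrassCurve ℚ) [W.IsElliptic] [W.IsGloballyMinimal] (hadd : Addv W p)
    (hr : W.analyticRank = 1) (Dh : PAdicHeightData W p) (h : ValRelationAt W p Dh) :
    BranchPAdicGrossZagierAt W p Dh := by
  intro V _ _ N _ f hp4 hVW hord hf ϖ hϖ
  obtain ⟨C, hC⟩ := hVW
  obtain ⟨s, -, hs⟩ := X11b.exists_rat_ne_zero_shaAn_eq_of_analyticRank_eq_one hGZ hGZK W hr
  have hord' : IsOrdinaryAt V p := hord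
  obtain ⟨heven, -⟩ := h V C f hadd (Or.inl hord'.1) hf hr s hs
  obtain ⟨hG, -⟩ := heven hp4 hC ϖ hϖ
  obtain ⟨-, hne, hn⟩ := hG hord'
  have hrk : W.mordellWeilRank = 1 := by rw [(hGZK W hr.le).1, hr]
  have hϖ0 : (ϖ : ℚ_[p]) ≠ 0 := periodRatio_ne_zero (p := p) hf (by
    rw [if_pos (show Even (p / 2) from ⟨p / 4, by omega⟩)]; exact hϖ)
  obtain ⟨u, hu⟩ := exists_unit_eq_of_norm_clause Dh hrk (lhs_ne_zero' hϖ0 hne) hn rfl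
  exact ⟨u, s * W.tamagawaProduct / (W.torsionOrder : ℚ) ^ 2, leadingLCoeff_eq_of_shaAn_eq W hs, hu⟩

/-- **Valuation relation ⟹ `BranchPAdicGrossZagierOddAt W p Dh`** (odd branch, (G-ord), rank one).
[cite: GrossZagier1986, Thm. I.(7.3)] [cite: MazurTateTeitelbaum1986Invent, §I.13] -/
theorem branchPAdicGrossZagierOddAt_of_valRelationAt (hGZ : GrossZagier1986_thm_I_7_3)
    (hGZK : rank_eq_analyticRank_of_analyticRank_le_one)
    (W : WeierstrassCurve ℚ) [W.IsElliptic] [W.IsGloballyMinimal] (hadd : Addv W p)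
    (hr : W.analyticRank = 1) (Dh : PAdicHeightData W p) (h : ValRelationAt W p Dh) :
    BranchPAdicGrossZagierOddAt W p Dh := by
  intro V _ _ N _ f hp4 hVW hV hf ϖ hϖ
  obtain ⟨C, hC⟩ := hVW
  obtain ⟨s, -, hs⟩ := X11b.exists_rat_ne_zero_shaAn_eq_of_analyticRank_eq_one hGZ hGZK W hr
  have hord : IsOrdinaryAt V p := hV
  obtain ⟨-, hodd⟩ := h V C f hadd (Or.inl hord.1) hf hr s hs
  obtain ⟨hG, -⟩ := hodd hp4 hC ϖ hϖ
  obtain ⟨-, hne, hn⟩ := hG hord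
  have hrk : W.mordellWeilRank = 1 := by rw [(hGZK W hr.le).1, hr]
  have hϖ0 : (ϖ : ℚ_[p]) ≠ 0 := periodRatio_ne_zero (p := p) hf (by
    rw [if_neg (show ¬ Even (p / 2) by rw [Nat.not_even_iff_odd]; exact ⟨p / 4, by omega⟩)]; exact hϖ)
  obtain ⟨u, hu⟩ := exists_unit_eq_of_norm_clause Dh hrk (lhs_ne_zero' hϖ0 hne) hn rfl
  exact ⟨u, s * W.tamagawaProduct / (W.torsionOrder : ℚ) ^ 2, leadingLCoeff_eq_of_shaAn_eq W hs, hu⟩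

/-- **Valuation relation ⟹ `BranchPAdicGrossZagierMultAt W p Dh`** ((M) locus, rank one, EVERY odd
`p`, both parities; `ã = a_p(E♭) = ±1` from split / non-split). [cite: GrossZagier1986, Thm. I.(7.3)]
[cite: MazurTateTeitelbaum1986Invent, §I.10, §I.13] -/
theorem branchPAdicGrossZagierMultAt_of_valRelationAt (hGZ : GrossZagier1986_thm_I_7_3)
    (hGZK : rank_eq_analyticRank_of_analyticRank_le_one)
    (W : WeierstrassCurve ℚ) [W.IsElliptic] [W.IsGloballyMinimal] (hadd : Addv W p)
    (hr : W.analyticRank = 1) (Dh : PAdicHeightData W p) (h : ValRelationAt W p Dh) :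
    BranchPAdicGrossZagierMultAt W p Dh := by
  intro V _ _ N _ f B hp2 hVW hB hf ϖ hϖ
  obtain ⟨C, hC⟩ := hVW
  obtain ⟨s, -, hs⟩ := X11b.exists_rat_ne_zero_shaAn_eq_of_analyticRank_eq_one hGZ hGZK W hr
  obtain ⟨hsplit, hnonsplit⟩ := intCast_LFunction_eq_of_split_or_nonsplit (p := p) hf
  have hVB : Mult V p ∧ B = (if Even (p / 2)
      then padicLFunctionPlusBranchMult f (((V.LFunction p : ℤ)) : ℚ_[p]) (p / 2)
      else padicLFunctionMinusBranchMult f (((V.LFunction p : ℤ)) : ℚ_[p]) (p / 2)) := by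
    rcases hB with ⟨hs', hB⟩ | ⟨hm, hns, hB⟩
    · exact ⟨hs'.hasMultiplicativeReductionAtPrime, by rw [hB, hsplit hs', Int.cast_one]⟩
    · exact ⟨hm, by rw [hB, hnonsplit hm hns, Int.cast_neg, Int.cast_one]⟩
  obtain ⟨hV, rfl⟩ := hVB
  obtain ⟨heven, hodd⟩ := h V C f hadd (Or.inr hV) hf hr s hs
  have hrk : W.mordellWeilRank = 1 := by rw [(hGZK W hr.le).1, hr]
  have hϖ0 : (ϖ : ℚ_[p]) ≠ 0 := periodRatio_ne_zero (p := p) hf hϖ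
  have hodd4 : p % 4 = 1 ∨ p % 4 = 3 := by
    obtain ⟨k, hk⟩ := hp.out.odd_of_ne_two hp2
    omega
  rcases hodd4 with h1 | h3
  · have hev : Even (p / 2) := ⟨p / 4, by omega⟩
    have hC' : C • V.quadraticTwist (p : ℚ) = W := by
      rw [pStar_eq_of_mod_four p (Or.inl h1), if_pos h1] at hC; exact hC
    rw [if_pos hev] at hϖ ⊢
    obtain ⟨-, hne, hn⟩ := (heven h1 hC' ϖ hϖ).2 hV
    obtain ⟨u, hu⟩ := exists_unit_eq_of_norm_clause Dh hrk (lhs_ne_zero' hϖ0 hne) hn rfl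
    exact ⟨u, s * W.tamagawaProduct / (W.torsionOrder : ℚ) ^ 2, leadingLCoeff_eq_of_shaAn_eq W hs, hu⟩
  · have hnev : ¬ Even (p / 2) := by rw [Nat.not_even_iff_odd]; exact ⟨p / 4, by omega⟩
    have hC' : C • V.quadraticTwist (-(p : ℚ)) = W := by
      rw [pStar_eq_of_mod_four p (Or.inr h3), if_neg (by omega)] at hC; exact hC
    rw [if_neg hnev] at hϖ ⊢
    obtain ⟨-, hne, hn⟩ := (hodd h3 hC' ϖ hϖ).2 hV
    obtain ⟨u, hu⟩ := exists_unit_eq_of_norm_clause Dh hrk (lhs_ne_zero' hϖ0 hne) hn rfl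
    exact ⟨u, s * W.tamagawaProduct / (W.torsionOrder : ℚ) ^ 2, leadingLCoeff_eq_of_shaAn_eq W hs, hu⟩

/-! ### §2 The `∀ Dh` suppliers: the `hGZ` hypothesis of every rank-one class theorem of team n1011 -/

/-- **(G-ord, `e = 2`), even branch:** `∀ Dh, LeadingTermClauses → ValRelationAt` ⟹ the hypothesis
`hGZ : ∀ Dh, LeadingTermClauses → SchneiderConjecture Dh ∧ BranchPAdicGrossZagierAt W p Dh` of p01's /
p16's class theorems. [cite: MazurTateTeitelbaum1986Invent, §I.13] [cite: GrossZagier1986, Thm. I.(7.3)] -/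
theorem forall_schneider_and_branchPAdicGrossZagierAt_of_forall_valRelationAt
    (hGZ : GrossZagier1986_thm_I_7_3) (hGZK : rank_eq_analyticRank_of_analyticRank_le_one)
    (hmodD : nonempty_modularParametrizationData) {W : WeierstrassCurve ℚ} [W.IsElliptic]
    [W.IsGloballyMinimal] (hp2 : p ≠ 2) (hG : TypeGOrd W p) (hadd : Addv W p)
    (he : semistabilityIndex W p = 2) (hr : W.analyticRank = 1)
    (hrel : ∀ Dh : PAdicHeightData W p, LeadingTermClauses W p Dh → ValRelationAt W p Dh) :
    ∀ Dh : PAdicHeightData W p, LeadingTermClauses W p Dh →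
      SchneiderConjecture Dh ∧ BranchPAdicGrossZagierAt W p Dh := fun Dh hB ↦
  ⟨schneider_of_valRelationAt hGZ hGZK hmodD hp2 hG hadd he hr (hrel Dh hB),
    branchPAdicGrossZagierAt_of_valRelationAt hGZ hGZK W hadd hr Dh (hrel Dh hB)⟩

/-- **(G-ord, `e = 2`), odd branch:** the same with `BranchPAdicGrossZagierOddAt`.
[cite: MazurTateTeitelbaum1986Invent, §I.13] [cite: GrossZagier1986, Thm. I.(7.3)] -/
theorem forall_schneider_and_branchPAdicGrossZagierOddAt_of_forall_valRelationAt
    (hGZ : GrossZagier1986_thm_I_7_3) (hGZK : rank_eq_analyticRank_of_analyticRank_le_one)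
    (hmodD : nonempty_modularParametrizationData) {W : WeierstrassCurve ℚ} [W.IsElliptic]
    [W.IsGloballyMinimal] (hp2 : p ≠ 2) (hG : TypeGOrd W p) (hadd : Addv W p)
    (he : semistabilityIndex W p = 2) (hr : W.analyticRank = 1)
    (hrel : ∀ Dh : PAdicHeightData W p, LeadingTermClauses W p Dh → ValRelationAt W p Dh) :
    ∀ Dh : PAdicHeightData W p, LeadingTermClauses W p Dh →
      SchneiderConjecture Dh ∧ BranchPAdicGrossZagierOddAt W p Dh := fun Dh hB ↦
  ⟨schneider_of_valRelationAt hGZ hGZK hmodD hp2 hG hadd he hr (hrel Dh hB),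
    branchPAdicGrossZagierOddAt_of_valRelationAt hGZ hGZK W hadd hr Dh (hrel Dh hB)⟩

/-- **(M):** `∀ Dh, LeadingTermClauses → ValRelationAt` ⟹ `∀ Dh, LeadingTermClauses →
SchneiderConjecture Dh ∧ BranchPAdicGrossZagierMultAt W p Dh` (p01 / p07 / p12 / p16's (M) hypothesis).
[cite: MazurTateTeitelbaum1986Invent, §I.10, §I.13] [cite: GrossZagier1986, Thm. I.(7.3)] -/
theorem forall_schneider_and_branchPAdicGrossZagierMultAt_of_forall_valRelationAt
    (hGZ : GrossZagier1986_thm_I_7_3) (hGZK : rank_eq_analyticRank_of_analyticRank_le_one)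
    (hmodD : nonempty_modularParametrizationData) {W : WeierstrassCurve ℚ} [W.IsElliptic]
    [W.IsGloballyMinimal] (hp2 : p ≠ 2) (hpm : AdditivePotMult.PotMult W p) (hr : W.analyticRank = 1)
    (hrel : ∀ Dh : PAdicHeightData W p, LeadingTermClauses W p Dh → ValRelationAt W p Dh) :
    ∀ Dh : PAdicHeightData W p, LeadingTermClauses W p Dh →
      SchneiderConjecture Dh ∧ BranchPAdicGrossZagierMultAt W p Dh := fun Dh hB ↦
  ⟨schneider_of_valRelationAt_mult hGZ hGZK hmodD hp2 hpm hr (hrel Dh hB),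
    branchPAdicGrossZagierMultAt_of_valRelationAt hGZ hGZK W hpm.1 hr Dh (hrel Dh hB)⟩

end CensusX42

/-! ### §3 Two IMC-version nodes at WINDOW grade (the §2 suppliers plugged into p01's class theorems) -/

open CensusX42

variable {W : WeierstrassCurve ℚ} [W.IsElliptic] [W.IsGloballyMinimal] {p : ℕ} [hp : Fact p.Prime]

/-- **IMC-VERSION NODE at WINDOW grade, (G-ord, `e = 2`) ∩ {`ρ̄` onto}, `p ≡ 1 (mod 4)`, non-anomalous,
`r_an = 1`:** Kato half + the typed Λ-adic LOWER `ChiBranchLowerDivisibilityAt W p` + Delbourgo 2002 +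
GZ + GZK + modularity + **the VALUATION relation for every (B)-datum** ⟹ `BSD(E,p)` (p01's
`ClassX4Gord.bsdp_rankOne_of_chiBranchLower_of_katoHalf_of_branchPAdicGrossZagier` fed by §2; non-CM
automatic at `p ≥ 5` from `ρ̄` onto; the window-grade twin of gen 4's `…_of_forall_censusX42`).
[cite: Kato2004Asterisque, Thm. 17.4 (3) (p. 273)] [cite: Delbourgo2002, Theorem (A), (B) (p. 40)]
[cite: GrossZagier1986, Thm. I.(7.3)] [cite: Miller2011LMS, Def. 1.1] -/
theorem ClassX4Gord.bsdp_rankOne_of_chiBranchLower_of_katoHalf_of_forall_censusX42Val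
    (hDel : Delbourgo2002.mainTheorem)
    (hK : Wuthrich2014.kato_halfEigenCharIdeal_dvd_cyclotomicPrime_of_surjective)
    (hGZ : GrossZagier1986_thm_I_7_3) (hmod : hasEntireLFunction_rat)
    (hmodD : nonempty_modularParametrizationData) (hGZK : rank_eq_analyticRank_of_analyticRank_le_one)
    (hX : ClassX4Gord W p) (he : semistabilityIndex W p = 2) (hp4 : p % 4 = 1)
    (hna : ReductionNonAnomalous W p) (hsurj : Surj W p) (hr : W.analyticRank = 1)
    (hdiv : ChiBranchLowerDivisibilityAt W p)
    (hrel : ∀ Dh : PAdicHeightData W p, LeadingTermClauses W p Dh → ValRelationAt W p Dh) : BSDp W p :=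
  have hp5 : 5 ≤ p := by have := hp.out.two_le; omega
  hX.bsdp_rankOne_of_chiBranchLower_of_katoHalf_of_branchPAdicGrossZagier hDel hK hmod hmodD hGZK he hp4
    (hX.not_hasCM_of_surj_of_five_le he hp5 hsurj) hna hsurj hr hdiv
    (forall_schneider_and_branchPAdicGrossZagierAt_of_forall_valRelationAt hGZ hGZK hmodD hX.addv.1
      hX.typeGOrd hX.addv.2 he hr hrel)

end Summit.BirchSwinnertonDyer.Rank1Residual.Additive

namespace Summit.BirchSwinnertonDyer.Rank1Residual.AdditivePotMult

open Additive CensusX42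

variable {W : WeierstrassCurve ℚ} [W.IsElliptic] [W.IsGloballyMinimal] {p : ℕ} [hp : Fact p.Prime]

/-- **IMC-VERSION NODE at WINDOW grade on X4(M) ∩ {`ρ̄_{E,p}` onto}, EVERY odd `p`, `r_an = 1`:** Kato
half + p10's typed LOWER `QuadraticBranchLowerDivisibilityAt V p` on every multiplicative twist model +
Delbourgo 2002 (M) + GZ + GZK + modularity + **the VALUATION relation for every (B)-datum** ⟹ `BSD(E,p)`
(p01's `ClassX4M.bsdp_rankOne_of_quadraticBranchLower_of_katoHalf_of_branchPAdicGrossZagierMult` fed by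
§2). [cite: Kato2004Asterisque, Thm. 17.4 (3) (p. 273)] [cite: Delbourgo2002, Theorem (A), (B), Example (p. 40)]
[cite: GrossZagier1986, Thm. I.(7.3)] [cite: Miller2011LMS, Def. 1.1] -/
theorem ClassX4M.bsdp_rankOne_of_quadraticBranchLower_of_katoHalf_of_forall_censusX42Val
    (hDelM : Delbourgo2002.mainTheorem_potMult)
    (hK : Wuthrich2014.kato_halfEigenCharIdeal_dvd_cyclotomicPrime_of_surjective)
    (hGZ : GrossZagier1986_thm_I_7_3) (hmod : hasEntireLFunction_rat)
    (hmodD : nonempty_modularParametrizationData) (hGZK : rank_eq_analyticRank_of_analyticRank_le_one)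
    (hX : ClassX4M W p) (hsurj : Surj W p) (hr : W.analyticRank = 1)
    (hc : ∀ (V : WeierstrassCurve ℚ) [V.IsElliptic] [V.IsGloballyMinimal],
      (∃ C : VariableChange ℚ, C • V.quadraticTwist ((-1) ^ (p / 2) * p : ℚ) = W) →
        QuadraticBranchLowerDivisibilityAt V p)
    (hrel : ∀ Dh : PAdicHeightData W p, LeadingTermClauses W p Dh → ValRelationAt W p Dh) : BSDp W p :=
  hX.bsdp_rankOne_of_quadraticBranchLower_of_katoHalf_of_branchPAdicGrossZagierMult hDelM hK hmod hmodD
    hGZK hsurj hr hc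
    (forall_schneider_and_branchPAdicGrossZagierMultAt_of_forall_valRelationAt hGZ hGZK hmodD hX.p_ne_two
      (ClassX4M.potMult W p hX) hr hrel)

end Summit.BirchSwinnertonDyer.Rank1Residual.AdditivePotMult

end
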